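import Summits.QuantumFields.YangMills.Theorems.FluctuationComparisonRegPrIntLOrganTangentDisintegrationTransport
import Summits.QuantumFields.YangMills.Theorems.FluctuationComparisonRegPrIntLOrganTangentFibreMeanVersionKnitDescendTo
import HarnessLib

/-!
# Crux `FluctuationComparisonRegPrIntL` (stmt-QuantumFields-20520, rung R3), PATH-B organ, v18 (H-currency) — (L21b) THE FIBRE-MEAN TRANSPORT IDENTITY:
# real ∕ normalised-weight editions of (L21a), the window upgrade, and the frame edition (`dU_{Ts}`, `descendTo F ℰp j Ts`, LINᵘ-H's `σ`-binder verbatim)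

Cell `ym3-torus` (YM ladder rung R3 = continuum `SU(2)` Yang–Mills on the three-torus — a RUNG: NOT d = 4, NOT infinite volume, NOT a mass gap, NOT Clay).
Width seat `ym-ust-20520-w5` (gen 23), `--supports stmt-QuantumFields-20520 --as helper`, count-neutral, no registry ∕ binder ∕ `Lines/` edit, DEFINITION-FREE,
default heartbeats.  Over (L21a) ✓`…OrganTangentDisintegrationTransport.ae_eq_transport` (`σ (g W) = (∫⁻ R ∂σ_W)⁻¹ • ((σ W).withDensity R).map τ` a.e.).

* §1 REAL EDITIONS (letter `r > 0` real, `R = ofReal ∘ r`): ★★`ae_integral_transport` — for `(m.map d)`-a.e. `W`, the fibre mass `∫ r ∂σ W > 0` and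
  `∫ f ∂σ(g W) = (∫ r·(f∘τ) ∂σ W) ∕ (∫ r ∂σ W)` for EVERY measurable `f` (ONE null set for all `f`); ★★`ae_ratio_transport` (the masses cancel);
  ★★★`ae_fibreMean_transport` — BRICK 2b's NORMALISED-WEIGHT corner shape: `(∫ h·b ∂σ(gW)) ∕ (∫ b ∂σ(gW)) = ∫ (h∘τ)·ŵ ∂σ W`, `ŵ = r·(b∘τ) ∕ ∫ r·(b∘τ) ∂σ W`,
  `∫ ŵ ∂σ W = 1` (in LINᵘ-H's frame `b = χ·ρ′`, `h = log ρ − log ρ′`, and the left side is `mfun (g W)`); `cv_comp_real` (real edition of (L21a) ★`cv_comp`).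
* §2 THE WINDOW UPGRADE (generic): a.e. `≤` ∕ `=` ∕ `|·| ≤ K` between window-continuous functions on an open window under an open-positive measure hold at EVERY
  window point (Mathlib `Measure.eqOn_open_of_ae_eq`) — the last step from a.e. corners to LINᵘ-H's `∀ U V W Z`.
* §3 THE FRAME EDITION (`Y = SU(2)^{bonds of T_{Ts}}`, `X = SU(2)^{bonds of T_j}`, `m = dU_{Ts}`, `d = descendTo F ℰp j Ts`, LINᵘ-H's `σ`-binder VERBATIM):
  ★`exists_measurableEquiv_oneBond` (the one-bond move `U ↦ update U b (U b·w)` of LINᵘ-H's corner relations IS a measurable equivalence, continuous;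
  `eq_update_of_oneBond` converts the RELATION form), ★★★`ae_fibreMean_transport_descendTo` ((i) mass `> 0`, (ii) integral form, (iii) 2b's corner shape —
  `(descendTo_* dU_{Ts})`-a.e.), ★★`ae_on_window_fibreMean_transport_descendTo` (the same `dU_j`-a.e. ON THE WINDOW `{PlaqSmall θ}` through ANY `mY ≪ dU_{Ts}` with
  `mY.map d = rj·dU_j`, `rj > 0` on the window — ✓`OrganTangentFibreMeanVersionKnit.ae_on_of_ae_map_of_ac_of_map_eq`, exactly as ✓(L17)∕(L20) move their
  conclusions), ★`abs_le_on_window_of_ae` ∕ `eq_on_window_of_ae` (`dU_j` charges open sets ✓`isOpenPosMeasure_fieldMeasure_SU`; the window is open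
  ✓`isOpen_setOf_plaqSmall_SU`).

HOW IT IS CONSUMED (LEAD's LIN knit over 2a ✓p805782 + 2b ✓p807533 + 3 + FIBRE-LAW-H): at a reference corner `U₀` with moves `g₁ = (b,v)`, `g₂ = (b′,v′)` and
hypothesis-form fine transports `τ₁, τ₂` (diagonal by (L21a) §3), §3 here gives — for a.e. `U₀`, then on the window — the displaced corners as `∫ (h∘τ)·ŵ ∂σ_{U₀}`
with normalised weights, i.e. 2b's `(Ω, P, F_ab, ŵ_ab)` with `P = σ_{U₀}`; 2b∕3 knit; §2∕§3 upgrade the a.e. bound to `∀ U V W Z`.  If FIBRE-LAW-H parametrises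
fibres by a fixed reference space instead (`T_V : Ω → fibre`), (L21a) §2 degenerates to a change of variables and §2∕§3 here still carry the any-`σ` reduction.

HONEST FRAMING: change-of-variables ∕ disintegration plumbing over Mathlib and landed kernel facts on Bałaban's (0.4) block average; NO transport, NO letter, NO
weight is constructed for the runs' towers (HYPOTHESES of SPREAD-TRANSPORT-H ∕ FIBRE-LAW-H); nothing of Bałaban's analysis is asserted or proved; LINᵘ-H ∕ JVARᵘ-H ∕
O1ᵘ-H v2 ∕ S1aᴴ ∕ 26243 ∕ S2α′ ∕ S2β OPEN; crux 20520 `FluctuationComparisonRegPrIntL` ∕ `YM3TorusSU2` NOT proved; no summit ∕ sub-problem statement is proved;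
registry untouched; rung R3 = SU(2) YM₃ on T³ at fixed lattice data — NOT d = 4, NOT infinite volume, NOT a mass gap, NOT Clay; the Yang–Mills mass gap is NOT
proved.  [folklore] measure theory; the frame citations are bookkeeping locators.
-/

set_option autoImplicit false

noncomputable section

namespace Summit.QuantumFields.YangMills.Theorems.OrganTangentFibreMeanTransport

open MeasureTheory ProbabilityTheory Filter Topology Set
open scoped ENNReal
open Summit.QuantumFields.YangMills.Theorems.OrganTangentDisintegrationTransport

/-! ## §1 Real-valued editions: the integral, ratio and NORMALISED-WEIGHT forms (the dock on BRICK 2b's `m_ab = ∫ F_ab·ŵ_ab ∂P`) -/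

section Integral

variable {X Y : Type*} [MeasurableSpace X] [MeasurableSpace Y]

/-- Integral against `c • ((μ.withDensity (ofReal ∘ r)).map τ)` = `c.toReal * ∫ r·(f∘τ) dμ`. [folklore] -/
theorem integral_smul_map_withDensity (μ : Measure Y) {τ : Y → Y} (hτ : Measurable τ)
    {r : Y → ℝ} (hr : Measurable r) (hr0 : ∀ U, 0 ≤ r U) (c : ℝ≥0∞) {f : Y → ℝ} (hf : Measurable f) :
    ∫ U, f U ∂(c • (μ.withDensity (fun U => ENNReal.ofReal (r U))).map τ) = c.toReal * ∫ U, r U * f (τ U) ∂μ := by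
  rw [integral_smul_measure, integral_map hτ.aemeasurable hf.aestronglyMeasurable,
    integral_withDensity_eq_integral_toReal_smul hr.ennreal_ofReal (Eventually.of_forall fun _ => ENNReal.ofReal_lt_top),
    smul_eq_mul]
  congr 1
  refine integral_congr_ae (Eventually.of_forall fun U => ?_)
  simp only [smul_eq_mul, ENNReal.toReal_ofReal (hr0 U)]

/-- The real fibre mass: `∫ r ∂μ = (∫⁻ ofReal ∘ r ∂μ).toReal` for `r ≥ 0` measurable. [folklore] -/
theorem integral_eq_toReal_lintegral (μ : Measure Y) {r : Y → ℝ} (hr : Measurable r) (hr0 : ∀ U, 0 ≤ r U) :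
    ∫ U, r U ∂μ = (∫⁻ U, ENNReal.ofReal (r U) ∂μ).toReal :=
  integral_eq_lintegral_of_nonneg_ae (Eventually.of_forall hr0) hr.aestronglyMeasurable

/-- ★★ **THE INTEGRAL FORM**: for `(m.map d)`-a.e. `W` and EVERY measurable `f : Y → ℝ`,
`∫ f ∂σ(g W) = (∫ r·(f∘τ) ∂σ W) ∕ (∫ r ∂σ W)` — ONE null set for all `f`. [folklore] -/
theorem ae_integral_transport [StandardBorelSpace Y] [Nonempty Y] [MeasurableSingletonClass X]
    (m : Measure Y) [IsFiniteMeasure m] {d : Y → X} (hd : Measurable d)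
    (σ : Kernel X Y) [IsMarkovKernel σ]
    (hbind : (m.map d).bind ⇑σ = m) (hfib : ∀ᵐ V ∂(m.map d), ∀ᵐ U ∂(σ V), d U = V)
    (g : X ≃ᵐ X) {τ : Y → Y} (hτ : Measurable τ) (hcov : ∀ U, d (τ U) = g (d U))
    {r : Y → ℝ} (hr : Measurable r) (hrpos : ∀ U, 0 < r U)
    (hcv : (m.withDensity (fun U => ENNReal.ofReal (r U))).map τ = m) :
    ∀ᵐ W ∂(m.map d), (0 < ∫ U, r U ∂(σ W)) ∧ ∀ f : Y → ℝ, Measurable f →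
      ∫ U, f U ∂(σ (g W)) = (∫ U, r U * f (τ U) ∂(σ W)) / (∫ U, r U ∂(σ W)) := by
  have hR : Measurable fun U => ENNReal.ofReal (r U) := hr.ennreal_ofReal
  have hRpos : ∀ U, ENNReal.ofReal (r U) ≠ 0 := fun U => (ENNReal.ofReal_pos.mpr (hrpos U)).ne'
  have hr0 : ∀ U, 0 ≤ r U := fun U => (hrpos U).le
  have h1 := ae_eq_transport m hd σ hbind hfib g hτ hcov hR hRpos hcv
  have h2 := ae_lintegral_kernel_lt_top m hd σ hbind hfib g.measurable hτ hcov hR hcv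
  filter_upwards [h1, h2] with W hW hWfin
  have hmass : ∫ U, r U ∂(σ W) = (∫⁻ U, ENNReal.ofReal (r U) ∂(σ W)).toReal := integral_eq_toReal_lintegral _ hr hr0
  have hmpos : 0 < ∫ U, r U ∂(σ W) := by
    rw [hmass]
    exact ENNReal.toReal_pos (lintegral_kernel_ne_zero σ hR hRpos W) hWfin.ne
  refine ⟨hmpos, fun f hf => ?_⟩
  rw [hW, integral_smul_map_withDensity _ hτ hr hr0 _ hf, ENNReal.toReal_inv, ← hmass, inv_mul_eq_div]

/-- ★★ **THE RATIO FORM** (the fibre masses cancel): for `(m.map d)`-a.e. `W` and all measurable `a b : Y → ℝ`,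
`(∫ a ∂σ(gW)) ∕ (∫ b ∂σ(gW)) = (∫ r·(a∘τ) ∂σ W) ∕ (∫ r·(b∘τ) ∂σ W)`. [folklore] -/
theorem ae_ratio_transport [StandardBorelSpace Y] [Nonempty Y] [MeasurableSingletonClass X]
    (m : Measure Y) [IsFiniteMeasure m] {d : Y → X} (hd : Measurable d)
    (σ : Kernel X Y) [IsMarkovKernel σ]
    (hbind : (m.map d).bind ⇑σ = m) (hfib : ∀ᵐ V ∂(m.map d), ∀ᵐ U ∂(σ V), d U = V)
    (g : X ≃ᵐ X) {τ : Y → Y} (hτ : Measurable τ) (hcov : ∀ U, d (τ U) = g (d U))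
    {r : Y → ℝ} (hr : Measurable r) (hrpos : ∀ U, 0 < r U)
    (hcv : (m.withDensity (fun U => ENNReal.ofReal (r U))).map τ = m) :
    ∀ᵐ W ∂(m.map d), ∀ a b : Y → ℝ, Measurable a → Measurable b →
      (∫ U, a U ∂(σ (g W))) / (∫ U, b U ∂(σ (g W)))
        = (∫ U, r U * a (τ U) ∂(σ W)) / (∫ U, r U * b (τ U) ∂(σ W)) := by
  filter_upwards [ae_integral_transport m hd σ hbind hfib g hτ hcov hr hrpos hcv] with W hW
  intro a b ha hb
  rw [hW.2 a ha, hW.2 b hb, div_div_div_cancel_right₀ hW.1.ne']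

/-- ★★★ **THE FIBRE-MEAN TRANSPORT IDENTITY IN NORMALISED-WEIGHT FORM** (BRICK 2b's corner shape `m = ∫ F·ŵ ∂P`, `∫ ŵ ∂P = 1`, with
`P := σ W` the REFERENCE corner's fibre law, `F := h ∘ τ`, `ŵ := r·(b∘τ) ∕ ∫ r·(b∘τ) ∂σ W`): for `(m.map d)`-a.e. `W` and all measurable
`h b : Y → ℝ` with `∫ r·(b∘τ) ∂σ W ≠ 0`,
`(∫ h·b ∂σ(gW)) ∕ (∫ b ∂σ(gW)) = ∫ (h∘τ)·ŵ ∂σ W` and `∫ ŵ ∂σ W = 1`.  (In LINᵘ-H's frame `b = χ·ρ′`, `h = log ρ − log ρ′`, and the left side is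
`mfun (g W)`.) [folklore] -/
theorem ae_fibreMean_transport [StandardBorelSpace Y] [Nonempty Y] [MeasurableSingletonClass X]
    (m : Measure Y) [IsFiniteMeasure m] {d : Y → X} (hd : Measurable d)
    (σ : Kernel X Y) [IsMarkovKernel σ]
    (hbind : (m.map d).bind ⇑σ = m) (hfib : ∀ᵐ V ∂(m.map d), ∀ᵐ U ∂(σ V), d U = V)
    (g : X ≃ᵐ X) {τ : Y → Y} (hτ : Measurable τ) (hcov : ∀ U, d (τ U) = g (d U))
    {r : Y → ℝ} (hr : Measurable r) (hrpos : ∀ U, 0 < r U)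
    (hcv : (m.withDensity (fun U => ENNReal.ofReal (r U))).map τ = m) :
    ∀ᵐ W ∂(m.map d), ∀ h b : Y → ℝ, Measurable h → Measurable b →
      (∫ U, r U * b (τ U) ∂(σ W)) ≠ 0 →
      (∫ U, h U * b U ∂(σ (g W))) / (∫ U, b U ∂(σ (g W)))
          = ∫ U, h (τ U) * (r U * b (τ U) / ∫ U', r U' * b (τ U') ∂(σ W)) ∂(σ W) ∧
        ∫ U, r U * b (τ U) / (∫ U', r U' * b (τ U') ∂(σ W)) ∂(σ W) = 1 := by
  filter_upwards [ae_ratio_transport m hd σ hbind hfib g hτ hcov hr hrpos hcv] with W hW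
  intro h b hh hb hD
  refine ⟨?_, ?_⟩
  · rw [hW (fun U => h U * b U) b (hh.mul hb) hb]
    rw [← integral_div]
    refine integral_congr_ae (Eventually.of_forall fun U => ?_)
    simp only
    ring
  · rw [integral_div, div_self hD]

/-- Real edition of ★`cv_comp` (`ofReal r₁ · ofReal (r₂∘τ₁) = ofReal (r₁·(r₂∘τ₁))` for `r₁ ≥ 0`). [folklore] -/
theorem cv_comp_real (m : Measure Y) {τ₁ τ₂ : Y → Y} (hτ₁ : Measurable τ₁) (hτ₂ : Measurable τ₂)
    {r₁ r₂ : Y → ℝ} (hr₁ : Measurable r₁) (hr₂ : Measurable r₂) (hr₁0 : ∀ U, 0 ≤ r₁ U)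
    (hcv₁ : (m.withDensity (fun U => ENNReal.ofReal (r₁ U))).map τ₁ = m)
    (hcv₂ : (m.withDensity (fun U => ENNReal.ofReal (r₂ U))).map τ₂ = m) :
    (m.withDensity (fun U => ENNReal.ofReal (r₁ U * r₂ (τ₁ U)))).map (τ₂ ∘ τ₁) = m := by
  have h := cv_comp m hτ₁ hτ₂ hr₁.ennreal_ofReal hr₂.ennreal_ofReal hcv₁ hcv₂
  have hfun : (fun U => ENNReal.ofReal (r₁ U * r₂ (τ₁ U))) = fun U => ENNReal.ofReal (r₁ U) * ENNReal.ofReal (r₂ (τ₁ U)) :=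
    funext fun U => ENNReal.ofReal_mul (hr₁0 U)
  rw [hfun]
  exact h

end Integral

/-! ## §2 The window upgrade: a.e. (in)equalities between window-continuous functions hold at EVERY window point -/

section Window

variable {Z : Type*} [TopologicalSpace Z] [MeasurableSpace Z] [OpensMeasurableSpace Z]

/-- ★ **a.e. `≤` ⇒ everywhere `≤` on an open window** for window-continuous functions under an open-positive measure. [folklore] -/
theorem le_on_of_ae_le (μ : Measure Z) [μ.IsOpenPosMeasure] {O : Set Z} (hO : IsOpen O) {f g : Z → ℝ}
    (hf : ContinuousOn f O) (hg : ContinuousOn g O) (h : ∀ᵐ x ∂μ, x ∈ O → f x ≤ g x) :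
    ∀ x ∈ O, f x ≤ g x := by
  have hmin : (fun x => f x ⊓ g x) =ᵐ[μ.restrict O] f := by
    rw [Filter.EventuallyEq, ae_restrict_iff' hO.measurableSet]
    filter_upwards [h] with x hx hxO
    exact inf_eq_left.mpr (hx hxO)
  have heq := Measure.eqOn_open_of_ae_eq hmin hO (hf.inf hg) hf
  intro x hx
  have hx' := heq hx
  simp only at hx'
  rw [← hx']
  exact inf_le_right

/-- ★ **a.e. `=` ⇒ everywhere `=` on an open window** (Mathlib `Measure.eqOn_open_of_ae_eq`, «`∀ᵐ x, x ∈ O → …`» binder shape). [folklore] -/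
theorem eq_on_of_ae_eq (μ : Measure Z) [μ.IsOpenPosMeasure] {O : Set Z} (hO : IsOpen O) {f g : Z → ℝ}
    (hf : ContinuousOn f O) (hg : ContinuousOn g O) (h : ∀ᵐ x ∂μ, x ∈ O → f x = g x) :
    ∀ x ∈ O, f x = g x := by
  have h' : f =ᵐ[μ.restrict O] g := by
    rw [Filter.EventuallyEq, ae_restrict_iff' hO.measurableSet]
    exact h
  exact fun x hx => Measure.eqOn_open_of_ae_eq h' hO hf hg hx

/-- ★ **a.e. `|·| ≤` ⇒ everywhere** (the shape of LINᵘ-H's conclusion: `|ΔΔ (mfun − counterterm)| ≤ k′·x·x′` at EVERY window corner from the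
a.e. edition delivered by the transport + BRICK 2b∕3). [folklore] -/
theorem abs_le_on_of_ae (μ : Measure Z) [μ.IsOpenPosMeasure] {O : Set Z} (hO : IsOpen O) {f : Z → ℝ} {K : ℝ}
    (hf : ContinuousOn f O) (h : ∀ᵐ x ∂μ, x ∈ O → |f x| ≤ K) : ∀ x ∈ O, |f x| ≤ K :=
  le_on_of_ae_le μ hO (hf.abs) continuousOn_const h

end Window

/-! ## §3 The frame edition: `Y = SU(2)^{bonds of T_{Ts}}`, `X = SU(2)^{bonds of T_j}`, `m = dU_{Ts}` (product Haar), `d = descendTo F ℰp j Ts` -/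

section Frame

open Literature.MathematicalPhysics.QuantumFieldTheory.Balaban1983to89
open T3ContinuumYM3Torus T3NestedUnitLaws T3UnitLawDensityEML T3UnitScaleTilt T3TiltDescent
open Literature.MathematicalPhysics.QuantumFieldTheory.Balaban1983to89.T3OrbitAverage
open Summit.QuantumFields.YangMills.BalabanUVNodes.N09DomAltThresholdNull (isOpen_setOf_plaqSmall_SU)
open Literature.MathematicalPhysics.QuantumFieldTheory.Balaban1983to89.B12ContinuousTransportInvariance (isOpenPosMeasure_fieldMeasure_SU)

/-- ★ **ONE-BOND MOVES ARE MEASURABLE EQUIVALENCES** (and continuous): for a bond `b` and a group element `w`, the coarse move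
`U ↦ update U b (U b * w)` of LINᵘ-H's corner relations is some `g : X ≃ᵐ X` (inverse: `w ↦ w⁻¹`). [folklore] -/
theorem exists_measurableEquiv_oneBond (P : Params) (j : ℕ) (b : PBond P j) (w : ↥(Matrix.specialUnitaryGroup (Fin 2) ℂ)) :
    ∃ g : GaugeField P j ↥(Matrix.specialUnitaryGroup (Fin 2) ℂ) ≃ᵐ GaugeField P j ↥(Matrix.specialUnitaryGroup (Fin 2) ℂ),
      (∀ U, g U = Function.update U b (U b * w)) ∧ (∀ U, g.symm U = Function.update U b (U b * w⁻¹)) ∧ Continuous g := by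
  have hmeas : ∀ w' : ↥(Matrix.specialUnitaryGroup (Fin 2) ℂ),
      Measurable fun U : GaugeField P j ↥(Matrix.specialUnitaryGroup (Fin 2) ℂ) => Function.update U b (U b * w') := by
    intro w'
    refine measurable_pi_lambda _ fun e => ?_
    have hev : Measurable (fun U : GaugeField P j ↥(Matrix.specialUnitaryGroup (Fin 2) ℂ) => U e) := measurable_pi_apply _
    by_cases he : e = b
    · subst he
      simp only [Function.update_self]
      exact hev.mul_const w'
    · simp only [Function.update_of_ne he]
      exact hev
  have hinv : ∀ (w' : ↥(Matrix.specialUnitaryGroup (Fin 2) ℂ)) (U : GaugeField P j ↥(Matrix.specialUnitaryGroup (Fin 2) ℂ)),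
      Function.update (Function.update U b (U b * w')) b ((Function.update U b (U b * w')) b * w'⁻¹) = U := by
    intro w' U
    funext e
    by_cases he : e = b
    · subst he
      simp only [Function.update_self, mul_inv_cancel_right]
    · simp only [Function.update_of_ne he]
  have hinv' : ∀ (w' : ↥(Matrix.specialUnitaryGroup (Fin 2) ℂ)) (U : GaugeField P j ↥(Matrix.specialUnitaryGroup (Fin 2) ℂ)),
      Function.update (Function.update U b (U b * w'⁻¹)) b ((Function.update U b (U b * w'⁻¹)) b * w') = U := by
    intro w' U
    have h := hinv w'⁻¹ U
    rwa [inv_inv] at h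
  refine ⟨⟨⟨fun U => Function.update U b (U b * w), fun U => Function.update U b (U b * w⁻¹), fun U => hinv w U, fun U => hinv' w U⟩,
    hmeas w, hmeas w⁻¹⟩, fun U => rfl, fun U => rfl, ?_⟩
  show Continuous fun U : GaugeField P j ↥(Matrix.specialUnitaryGroup (Fin 2) ℂ) => Function.update U b (U b * w)
  refine continuous_pi fun e => ?_
  have hev : Continuous (fun U : GaugeField P j ↥(Matrix.specialUnitaryGroup (Fin 2) ℂ) => U e) := continuous_apply _
  by_cases he : e = b
  · subst he
    simp only [Function.update_self]
    exact hev.mul continuous_const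
  · simp only [Function.update_of_ne he]
    exact hev

/-- LINᵘ-H's corner RELATION `(∀ e ≠ b, V e = U e) ∧ V b = U b * w` is the one-bond move in FUNCTION form. [folklore] -/
theorem eq_update_of_oneBond {P : Params} {j : ℕ} {G : Type*} {b : PBond P j} {U V : GaugeField P j G} {w : G} [Mul G]
    (hVU : ∀ e, e ≠ b → V e = U e) (hVb : V b = U b * w) : V = Function.update U b (U b * w) := by
  funext e
  by_cases he : e = b
  · subst he; rw [Function.update_self, hVb]
  · rw [Function.update_of_ne he, hVU e he]

/-- ★★★ **THE FIBRE-MEAN TRANSPORT IDENTITY IN THE FRAME OF LINᵘ-H** (`σ` ANY disintegration of `dU_{Ts}` along `descendTo F ℰp j Ts` — the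
`σ`-binder of LINᵘ-H ∕ JENᵘ-H ∕ O1ᵘ-H v2 VERBATIM; `g` a coarse measurable equivalence, `τ` a fine measurable transport COVERING it, `r > 0` its
change-of-variables letter `(r·dU_{Ts}).map τ = dU_{Ts}`): for `(descendTo_* dU_{Ts})`-a.e. reference corner `W` — (i) the fibre mass `∫ r ∂σ W` is
positive; (ii) `∫ f ∂σ(g W) = (∫ r·(f∘τ) ∂σ W) ∕ (∫ r ∂σ W)` for EVERY measurable `f`; (iii) BRICK 2b's corner shape: for all measurable `h b` with
`∫ r·(b∘τ) ∂σ W ≠ 0`, `(∫ h·b ∂σ(gW)) ∕ (∫ b ∂σ(gW)) = ∫ (h∘τ)·ŵ ∂σ W` with `ŵ = r·(b∘τ) ∕ ∫ r·(b∘τ) ∂σ W`, `∫ ŵ ∂σ W = 1`.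
[cite: Balaban1985Averaging, (10)-(13) p.19; Balaban1987RG1, (0.11) p.253] (bookkeeping over the (0.4) block average; [folklore] disintegration) -/
theorem ae_fibreMean_transport_descendTo (F : T3Family) (j Ts : ℕ) (hjTs : j + 1 ≤ Ts)
    (σ : Kernel (GaugeField (F.P j) 0 ↥(Matrix.specialUnitaryGroup (Fin 2) ℂ)) (GaugeField (F.P Ts) 0 ↥(Matrix.specialUnitaryGroup (Fin 2) ℂ)))
    (hσM : IsMarkovKernel σ)
    (hbind : (Measure.map (descendTo F ℰp j Ts (Nat.le_of_succ_le hjTs)) (fieldMeasure (F.P Ts) 0 ↥(Matrix.specialUnitaryGroup (Fin 2) ℂ))).bind ⇑σ =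
      fieldMeasure (F.P Ts) 0 ↥(Matrix.specialUnitaryGroup (Fin 2) ℂ))
    (hfib : ∀ᵐ V ∂(Measure.map (descendTo F ℰp j Ts (Nat.le_of_succ_le hjTs)) (fieldMeasure (F.P Ts) 0 ↥(Matrix.specialUnitaryGroup (Fin 2) ℂ))),
      ∀ᵐ U ∂(σ V), descendTo F ℰp j Ts (Nat.le_of_succ_le hjTs) U = V)
    (g : GaugeField (F.P j) 0 ↥(Matrix.specialUnitaryGroup (Fin 2) ℂ) ≃ᵐ GaugeField (F.P j) 0 ↥(Matrix.specialUnitaryGroup (Fin 2) ℂ))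
    {τ : GaugeField (F.P Ts) 0 ↥(Matrix.specialUnitaryGroup (Fin 2) ℂ) → GaugeField (F.P Ts) 0 ↥(Matrix.specialUnitaryGroup (Fin 2) ℂ)}
    (hτ : Measurable τ) (hcov : ∀ U, descendTo F ℰp j Ts (Nat.le_of_succ_le hjTs) (τ U) = g (descendTo F ℰp j Ts (Nat.le_of_succ_le hjTs) U))
    {r : GaugeField (F.P Ts) 0 ↥(Matrix.specialUnitaryGroup (Fin 2) ℂ) → ℝ} (hr : Measurable r) (hrpos : ∀ U, 0 < r U)
    (hcv : ((fieldMeasure (F.P Ts) 0 ↥(Matrix.specialUnitaryGroup (Fin 2) ℂ)).withDensity (fun U => ENNReal.ofReal (r U))).map τ =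
      fieldMeasure (F.P Ts) 0 ↥(Matrix.specialUnitaryGroup (Fin 2) ℂ)) :
    ∀ᵐ W ∂(Measure.map (descendTo F ℰp j Ts (Nat.le_of_succ_le hjTs)) (fieldMeasure (F.P Ts) 0 ↥(Matrix.specialUnitaryGroup (Fin 2) ℂ))),
      (0 < ∫ U, r U ∂(σ W)) ∧
      (∀ f : GaugeField (F.P Ts) 0 ↥(Matrix.specialUnitaryGroup (Fin 2) ℂ) → ℝ, Measurable f →
        ∫ U, f U ∂(σ (g W)) = (∫ U, r U * f (τ U) ∂(σ W)) / (∫ U, r U ∂(σ W))) ∧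
      (∀ h b : GaugeField (F.P Ts) 0 ↥(Matrix.specialUnitaryGroup (Fin 2) ℂ) → ℝ, Measurable h → Measurable b →
        (∫ U, r U * b (τ U) ∂(σ W)) ≠ 0 →
        (∫ U, h U * b U ∂(σ (g W))) / (∫ U, b U ∂(σ (g W)))
            = ∫ U, h (τ U) * (r U * b (τ U) / ∫ U', r U' * b (τ U') ∂(σ W)) ∂(σ W) ∧
          ∫ U, r U * b (τ U) / (∫ U', r U' * b (τ U') ∂(σ W)) ∂(σ W) = 1) := by
  haveI := hσM
  haveI : IsProbabilityMeasure (fieldMeasure (F.P Ts) 0 ↥(Matrix.specialUnitaryGroup (Fin 2) ℂ)) :=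
    Missing.isProbabilityMeasure_fieldMeasure _ _
  haveI : Nonempty (GaugeField (F.P Ts) 0 ↥(Matrix.specialUnitaryGroup (Fin 2) ℂ)) := ⟨fun _ => 1⟩
  have hd : Measurable (descendTo F ℰp j Ts (Nat.le_of_succ_le hjTs) :
      GaugeField (F.P Ts) 0 ↥(Matrix.specialUnitaryGroup (Fin 2) ℂ) → GaugeField (F.P j) 0 ↥(Matrix.specialUnitaryGroup (Fin 2) ℂ)) :=
    measurable_descendTo F ℰp measurableE_ℰp _
  filter_upwards [ae_integral_transport _ hd σ hbind hfib g hτ hcov hr hrpos hcv,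
    ae_fibreMean_transport _ hd σ hbind hfib g hτ hcov hr hrpos hcv] with W h1 h2
  exact ⟨h1.1, h1.2, h2⟩

/-- ★★ **… AND `dU_j`-a.e. ON THE WINDOW** — the `(descendTo_* dU_{Ts})`-a.e. conclusion of ★★★`ae_fibreMean_transport_descendTo` moved to «`dU_j`-a.e. on
`{PlaqSmall θ}`» through ANY `mY ≪ dU_{Ts}` with `mY.map (descendTo j Ts) = rj·dU_j`, `rj > 0` on the window (✓`OrganTangentFibreMeanVersionKnit.ae_on_of_ae_map_of_ac_of_map_eq`;
in O1ᵘ-H v2's frame `mY` = the cut run tower's top law, as in ✓(L17)∕(L20)). [cite: Balaban1985Averaging, (10)-(13) p.19; Balaban1987RG1, (0.13) p.254] -/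
theorem ae_on_window_fibreMean_transport_descendTo (F : T3Family) (j Ts : ℕ) (hjTs : j + 1 ≤ Ts) (θ : ℝ)
    (σ : Kernel (GaugeField (F.P j) 0 ↥(Matrix.specialUnitaryGroup (Fin 2) ℂ)) (GaugeField (F.P Ts) 0 ↥(Matrix.specialUnitaryGroup (Fin 2) ℂ)))
    (hσM : IsMarkovKernel σ)
    (hbind : (Measure.map (descendTo F ℰp j Ts (Nat.le_of_succ_le hjTs)) (fieldMeasure (F.P Ts) 0 ↥(Matrix.specialUnitaryGroup (Fin 2) ℂ))).bind ⇑σ =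
      fieldMeasure (F.P Ts) 0 ↥(Matrix.specialUnitaryGroup (Fin 2) ℂ))
    (hfib : ∀ᵐ V ∂(Measure.map (descendTo F ℰp j Ts (Nat.le_of_succ_le hjTs)) (fieldMeasure (F.P Ts) 0 ↥(Matrix.specialUnitaryGroup (Fin 2) ℂ))),
      ∀ᵐ U ∂(σ V), descendTo F ℰp j Ts (Nat.le_of_succ_le hjTs) U = V)
    (g : GaugeField (F.P j) 0 ↥(Matrix.specialUnitaryGroup (Fin 2) ℂ) ≃ᵐ GaugeField (F.P j) 0 ↥(Matrix.specialUnitaryGroup (Fin 2) ℂ))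
    {τ : GaugeField (F.P Ts) 0 ↥(Matrix.specialUnitaryGroup (Fin 2) ℂ) → GaugeField (F.P Ts) 0 ↥(Matrix.specialUnitaryGroup (Fin 2) ℂ)}
    (hτ : Measurable τ) (hcov : ∀ U, descendTo F ℰp j Ts (Nat.le_of_succ_le hjTs) (τ U) = g (descendTo F ℰp j Ts (Nat.le_of_succ_le hjTs) U))
    {r : GaugeField (F.P Ts) 0 ↥(Matrix.specialUnitaryGroup (Fin 2) ℂ) → ℝ} (hr : Measurable r) (hrpos : ∀ U, 0 < r U)
    (hcv : ((fieldMeasure (F.P Ts) 0 ↥(Matrix.specialUnitaryGroup (Fin 2) ℂ)).withDensity (fun U => ENNReal.ofReal (r U))).map τ =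
      fieldMeasure (F.P Ts) 0 ↥(Matrix.specialUnitaryGroup (Fin 2) ℂ))
    (mY : Measure (GaugeField (F.P Ts) 0 ↥(Matrix.specialUnitaryGroup (Fin 2) ℂ)))
    (hmY : mY ≪ fieldMeasure (F.P Ts) 0 ↥(Matrix.specialUnitaryGroup (Fin 2) ℂ))
    (rj : GaugeField (F.P j) 0 ↥(Matrix.specialUnitaryGroup (Fin 2) ℂ) → ℝ) (hrj : Measurable rj) (hrjpos : ∀ V, PlaqSmall θ V → 0 < rj V)
    (hcons : mY.map (descendTo F ℰp j Ts (Nat.le_of_succ_le hjTs)) =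
      (fieldMeasure (F.P j) 0 ↥(Matrix.specialUnitaryGroup (Fin 2) ℂ)).withDensity (fun V => ENNReal.ofReal (rj V))) :
    ∀ᵐ W ∂(fieldMeasure (F.P j) 0 ↥(Matrix.specialUnitaryGroup (Fin 2) ℂ)), PlaqSmall θ W →
      (0 < ∫ U, r U ∂(σ W)) ∧
      (∀ f : GaugeField (F.P Ts) 0 ↥(Matrix.specialUnitaryGroup (Fin 2) ℂ) → ℝ, Measurable f →
        ∫ U, f U ∂(σ (g W)) = (∫ U, r U * f (τ U) ∂(σ W)) / (∫ U, r U ∂(σ W))) ∧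
      (∀ h b : GaugeField (F.P Ts) 0 ↥(Matrix.specialUnitaryGroup (Fin 2) ℂ) → ℝ, Measurable h → Measurable b →
        (∫ U, r U * b (τ U) ∂(σ W)) ≠ 0 →
        (∫ U, h U * b U ∂(σ (g W))) / (∫ U, b U ∂(σ (g W)))
            = ∫ U, h (τ U) * (r U * b (τ U) / ∫ U', r U' * b (τ U') ∂(σ W)) ∂(σ W) ∧
          ∫ U, r U * b (τ U) / (∫ U', r U' * b (τ U') ∂(σ W)) ∂(σ W) = 1) := by
  have hd : Measurable (descendTo F ℰp j Ts (Nat.le_of_succ_le hjTs) :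
      GaugeField (F.P Ts) 0 ↥(Matrix.specialUnitaryGroup (Fin 2) ℂ) → GaugeField (F.P j) 0 ↥(Matrix.specialUnitaryGroup (Fin 2) ℂ)) :=
    measurable_descendTo F ℰp measurableE_ℰp _
  have hkey := ae_fibreMean_transport_descendTo F j Ts hjTs σ hσM hbind hfib g hτ hcov hr hrpos hcv
  have hρX : AEMeasurable (fun V => ENNReal.ofReal (rj V)) (fieldMeasure (F.P j) 0 ↥(Matrix.specialUnitaryGroup (Fin 2) ℂ)) :=
    hrj.ennreal_ofReal.aemeasurable
  have hWne : ∀ V ∈ {V : GaugeField (F.P j) 0 ↥(Matrix.specialUnitaryGroup (Fin 2) ℂ) | PlaqSmall θ V}, ENNReal.ofReal (rj V) ≠ 0 :=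
    fun V hV => (ENNReal.ofReal_pos.mpr (hrjpos V hV)).ne'
  exact OrganTangentFibreMeanVersionKnit.ae_on_of_ae_map_of_ac_of_map_eq _ hd _ mY hmY hρX hcons hWne hkey

/-- ★ **THE WINDOW UPGRADE IN THE FRAME**: `dU_j` charges every open set (✓`isOpenPosMeasure_fieldMeasure_SU`) and `{PlaqSmall θ}` is open
(✓`isOpen_setOf_plaqSmall_SU`), so an a.e. bound `|f| ≤ K` on the window for a window-continuous `f` holds at EVERY window point — the last step from
the a.e. corners above to LINᵘ-H's `∀ U V W Z` conclusion. [cite: Balaban1987RG1, p.259 and (1.2) p.260] (bookkeeping; [folklore]) -/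
theorem abs_le_on_window_of_ae (P : Params) (j : ℕ) (θ K : ℝ)
    {f : GaugeField P j ↥(Matrix.specialUnitaryGroup (Fin 2) ℂ) → ℝ}
    (hf : ContinuousOn f {V | PlaqSmall θ V})
    (h : ∀ᵐ V ∂(fieldMeasure P j ↥(Matrix.specialUnitaryGroup (Fin 2) ℂ)), PlaqSmall θ V → |f V| ≤ K) :
    ∀ V : GaugeField P j ↥(Matrix.specialUnitaryGroup (Fin 2) ℂ), PlaqSmall θ V → |f V| ≤ K := by
  haveI := isOpenPosMeasure_fieldMeasure_SU 2 P j
  exact fun V hV => abs_le_on_of_ae _ (isOpen_setOf_plaqSmall_SU 2 P j θ) hf h V hV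

/-- ★ Equality edition of the window upgrade (two window-continuous functions agreeing `dU_j`-a.e. on the window agree ON the window — e.g. two
continuous versions `mfun`, `mfun′` of the same fibre mean). [cite: Balaban1987RG1, p.259] (bookkeeping; [folklore]) -/
theorem eq_on_window_of_ae (P : Params) (j : ℕ) (θ : ℝ)
    {f f' : GaugeField P j ↥(Matrix.specialUnitaryGroup (Fin 2) ℂ) → ℝ}
    (hf : ContinuousOn f {V | PlaqSmall θ V}) (hf' : ContinuousOn f' {V | PlaqSmall θ V})
    (h : ∀ᵐ V ∂(fieldMeasure P j ↥(Matrix.specialUnitaryGroup (Fin 2) ℂ)), PlaqSmall θ V → f V = f' V) :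
    ∀ V : GaugeField P j ↥(Matrix.specialUnitaryGroup (Fin 2) ℂ), PlaqSmall θ V → f V = f' V := by
  haveI := isOpenPosMeasure_fieldMeasure_SU 2 P j
  exact fun V hV => eq_on_of_ae_eq _ (isOpen_setOf_plaqSmall_SU 2 P j θ) hf hf' h V hV

/-- ★ Generic-window frame edition: ANY open `O ⊆ SU(2)^{bonds}` (e.g. the four-corner window `{U | U, g₁U, g₂U, g₂g₁U ∈ {PlaqSmall (θ∕4)}}` of LINᵘ-H's
conclusion — open by the continuity in ★`exists_measurableEquiv_oneBond` and ✓`isOpen_setOf_plaqSmall_SU`): an a.e. bound `|f| ≤ K` on `O` for an `O`-continuous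
`f` holds at every point of `O`. [cite: Balaban1987RG1, p.259] (bookkeeping; [folklore]) -/
theorem abs_le_on_of_ae_fieldMeasure (P : Params) (j : ℕ) {O : Set (GaugeField P j ↥(Matrix.specialUnitaryGroup (Fin 2) ℂ))} (hO : IsOpen O)
    (K : ℝ) {f : GaugeField P j ↥(Matrix.specialUnitaryGroup (Fin 2) ℂ) → ℝ} (hf : ContinuousOn f O)
    (h : ∀ᵐ V ∂(fieldMeasure P j ↥(Matrix.specialUnitaryGroup (Fin 2) ℂ)), V ∈ O → |f V| ≤ K) : ∀ V ∈ O, |f V| ≤ K := by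
  haveI := isOpenPosMeasure_fieldMeasure_SU 2 P j
  exact abs_le_on_of_ae _ hO hf h

/-- The four-corner window of two one-bond moves is open. [folklore] -/
theorem isOpen_fourCornerWindow (P : Params) (j : ℕ) (θ : ℝ)
    {g₁ g₂ : GaugeField P j ↥(Matrix.specialUnitaryGroup (Fin 2) ℂ) → GaugeField P j ↥(Matrix.specialUnitaryGroup (Fin 2) ℂ)}
    (hg₁ : Continuous g₁) (hg₂ : Continuous g₂) :
    IsOpen {U : GaugeField P j ↥(Matrix.specialUnitaryGroup (Fin 2) ℂ) |
      PlaqSmall θ U ∧ PlaqSmall θ (g₁ U) ∧ PlaqSmall θ (g₂ U) ∧ PlaqSmall θ (g₂ (g₁ U))} := by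
  have hW : IsOpen {U : GaugeField P j ↥(Matrix.specialUnitaryGroup (Fin 2) ℂ) | PlaqSmall θ U} := isOpen_setOf_plaqSmall_SU 2 P j θ
  have h := (hW.and (hW.preimage hg₁)).and ((hW.preimage hg₂).and (hW.preimage (hg₂.comp hg₁)))
  have hset : {U : GaugeField P j ↥(Matrix.specialUnitaryGroup (Fin 2) ℂ) |
      PlaqSmall θ U ∧ PlaqSmall θ (g₁ U) ∧ PlaqSmall θ (g₂ U) ∧ PlaqSmall θ (g₂ (g₁ U))}
      = {U | (PlaqSmall θ U ∧ g₁ U ∈ {U : GaugeField P j ↥(Matrix.specialUnitaryGroup (Fin 2) ℂ) | PlaqSmall θ U}) ∧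
          (g₂ U ∈ {U : GaugeField P j ↥(Matrix.specialUnitaryGroup (Fin 2) ℂ) | PlaqSmall θ U} ∧
            (g₂ ∘ g₁) U ∈ {U : GaugeField P j ↥(Matrix.specialUnitaryGroup (Fin 2) ℂ) | PlaqSmall θ U})} := by
    ext U
    simp only [Set.mem_setOf_eq, Function.comp_apply, and_assoc]
  rw [hset]
  exact h

end Frame

end Summit.QuantumFields.YangMills.Theorems.OrganTangentFibreMeanTransport

end
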